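import Summits.BirchSwinnertonDyer.Rank1Residual.Supersingular.SignedLambdaParityTwoMazurTate
import Summits.BirchSwinnertonDyer.Rank1Residual.Supersingular.MazurTateReduction
import HarnessLib

/-!
# The ONE-LAYER λ-READING of an Iwasawa function through the Mazur–Tate construction congruence
# (any prime; the ORDINARY shape `u·L = Θₙ − β·Φ_{pⁿ}(1+T)·Θₘ + ωₙ·Q` as a BINDER), and at `p = 2`
# the transfer of the Θ-level parity law `(−1)^λ = χ₈(N)` to any such function
# (cell `b2b-bsdres`, O1 sub-cell `p = 2`; lens-1 GEN 9 packet A `G9_OrdinaryLayerReading.lean`,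
# ported by cc-typer-4 GEN 7 as typer queue item "packet A" of o1 lead rulings R-G21.3 / C178 (e) /
# C194 queue v3.15)

HONEST FRAMING (run/shared/lean/b2b/bsd-rank1-residual/, verbatim in every file): the goal of the
cell is to DELETE the COMBINATION-SHAPED residual classes of the Birch–Swinnerton-Dyer formula for
ALL analytic-rank `≤ 1` elliptic curves over `ℚ` — "full BSD formula for every rank `≤ 1` curve in
class `C`" assembled STRICTLY from published theorems — so that the rank-`≤ 1` remainder becomes
exactly the CONSTRUCTION-SHAPED classes, which are TYPED (missing-input `Prop`s), NOT attempted.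
This is not "finishing BSD". THEOREMS ONLY about typed objects (`IwasawaAlgebra p`, `mu`, `lam`,
`red`, `mazurTateElement`); every hypothesis explicit. In particular the construction congruence
`u · L = θ_n − β · Φ_{pⁿ}(1+T) · θ_{n−1} + ω_n · Q` in `Λ` (Mazur–Tate–Teitelbaum §I.10 (10.3): for
a good ORDINARY prime, `L_p(f, α) ≡ α^{−(n+1)}(θ_n − α^{−1} ν_{n−1,n} θ_{n−1}) (mod ω_n)`,
`ν_{n−1,n}` = multiplication by `Φ_{pⁿ}(1+T) = ω_n/ω_{n−1}`, `u = α^{n+e₀}` a unit) is a BINDER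
`hrel`, not a lemma smuggled in: the tree's `padicLFunction f (unitRoot W p)` is built from Riemann
sums of the MSD measure and its congruence with the Mazur–Tate elements is not (yet) a tree
theorem. Nothing about any particular curve is asserted; nothing is booked; no label moves.

## What is proved

* §1 `red (Φ_{p^{k+1}}(1+T)) = T^{p^k (p−1)}` in `𝔽_p⟦T⟧` (Eisenstein), `ord_T (c · A) = ord_T A`
  for a unit constant.
* §2 **THE READING** (`lam_eq_of_layer`, `lam_eq_of_layer'`): if
  `C u · L = Θₙ − C β · Φ_{p^{k+1}}(1+T) · Θₘ + ω_{k+1} · Q` in `Λ = ℤ_p⟦T⟧` with `u ∈ ℤ_p^×`,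
  `β ∈ ℤ_p` and `Θₘ, Q ∈ Λ` ARBITRARY, then `μ(L) = 0 ∧ λ(L) < p^k(p−1)` and
  `μ(Θₙ) = 0 ∧ λ(Θₙ) < p^k(p−1)` are equivalent and then `λ(L) = λ(Θₙ)` — because
  `Φ_{p^{k+1}}(1+T) ≡ T^{p^k(p−1)}` and `ω_{k+1} ≡ T^{p^{k+1}}` modulo `p`.
* §3 **AT `p = 2`** (`neg_one_pow_lam_of_layer_two`): with `Θₙ` an integral model of `θ_n(f)`
  (level `2^{n+2}`, `n ≥ 2`), `f ∈ S₂(Γ₀(N))` with a Fricke sign, `2 ∤ N`: `L ≠ 0`, `μ(L) = 0`,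
  `λ(L) < 2^{n−1}` ⇒ `(−1)^{λ(L)} = χ₈(N)` and `Even λ(L) ↔ N ≡ ±1 (mod 8)`. For the `2`-adic
  `L`-function of a curve good ordinary at `2` the Λ-level law is ALREADY a tree theorem by the
  functional-equation road
  (`Literature.Barriers.BirchSwinnertonDyer.even_firstUnitCoeff_iff_conductorNorm_mod_eight`);
  the content here is the READING `λ(L) = λ(θ_n)` at an explicit layer, which is what a θ-based
  engine computes (honest value: the check-digit lemma behind every "λ stabilised at level n"
  table line; o1 lead R-G21.3).

CREDIT. This is the o1 lens-1 GEN 9 packet A `HOME/b2b-bsdres-o1-idea-1-g9/lean/G9_OrdinaryLayerReading.lean`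
(planner-b2b-bsdres-o1-idea-1-g9-0; source sha16 `5bbb05d3a69af7e0`, 293 l.), ported VERBATIM up to:
this docstring, the `LensOneG9` sub-namespace dropped (as for the G8 / G9 B, C / G10 ports), and
one citation tag added to `even_lam_of_layer_two_iff`.

References: B. Mazur, J. Tate, J. Teitelbaum, Invent. Math. 84 (1986) §I.10
[MazurTateTeitelbaum1986Invent]; R. Pollack, T. Weston, Duke Math. J. 156 (2011) (Mazur–Tate
elements; `λ(θ_n)` stabilises to `λ(L_p)` in the ordinary `μ = 0` case) [PollackWeston2011];
L. Washington, GTM 83 §7.1 [Washington1997]. Folder record: `HOME/class-closure/O1/TYPING.md` §10b.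
-/

set_option autoImplicit false

noncomputable section

open scoped Classical MatrixGroups ModularForm

open Polynomial CongruenceSubgroup Literature.NumberTheory.EllipticCurves
  Literature.NumberTheory.EllipticCurves.ModularForms
  Literature.NumberTheory.EllipticCurves.Sprung2017
  Summit.BirchSwinnertonDyer.Rank1Residual.X1.MuLambda

namespace Summit.BirchSwinnertonDyer.Rank1Residual.Supersingular

/-! ## §1. Reductions modulo `p` -/

section Reduction

variable {p : ℕ} [hp : Fact p.Prime]

/-- `deg Φ_{p^{k+1}}(1+T) = p^k (p − 1)`. [folklore] -/
theorem natDegree_cyclotomic_comp_X_add_one (k : ℕ) :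
    ((cyclotomic (p ^ (k + 1)) ℤ).comp (X + 1)).natDegree = p ^ k * (p - 1) := by
  rw [natDegree_comp, natDegree_cyclotomic, Nat.totient_prime_pow_succ hp.out, ← C_1, natDegree_X_add_C,
    mul_one]

/-- `red (Φ_{p^{k+1}}(1+T)) = T^{p^k(p−1)}` in `𝔽_p⟦T⟧` (Eisenstein at `p`). [folklore] -/
theorem red_toIwasawa_cyclotomic_comp (k : ℕ) :
    red (toIwasawa p ((cyclotomic (p ^ (k + 1)) ℤ).comp (X + 1))) =
      (PowerSeries.X : PowerSeries (IsLocalRing.ResidueField ℤ_[p])) ^ (p ^ k * (p - 1)) := by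
  rw [red_toIwasawa, map_residue_cyclotomic_comp, natDegree_cyclotomic_comp_X_add_one,
    Polynomial.coe_pow, Polynomial.coe_X]

/-- `red (C c) = C c̄`. [folklore] -/
theorem red_C (c : ℤ_[p]) :
    red (PowerSeries.C c : IwasawaAlgebra p) = PowerSeries.C (IsLocalRing.residue ℤ_[p] c) := by
  rw [red, PowerSeries.map_C]

/-- `red` is multiplicative. [folklore] -/
theorem red_mul (a b : IwasawaAlgebra p) : red (a * b) = red a * red b := map_mul _ a b

/-- `red` is additive. [folklore] -/
theorem red_add (a b : IwasawaAlgebra p) : red (a + b) = red a + red b := map_add _ a b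

/-- `red` respects subtraction. [folklore] -/
theorem red_sub (a b : IwasawaAlgebra p) : red (a - b) = red a - red b := map_sub _ a b

/-- The residue of a unit of `ℤ_p` is non-zero. [folklore] -/
theorem residue_ne_zero_of_isUnit {u : ℤ_[p]} (hu : IsUnit u) : IsLocalRing.residue ℤ_[p] u ≠ 0 :=
  (hu.map _).ne_zero

/-- `ord_T (c · A) = ord_T A` for a non-zero constant `c` over a field. [folklore] -/
theorem order_C_mul {k : Type*} [Field k] {c : k} (hc : c ≠ 0) (A : PowerSeries k) :
    (PowerSeries.C c * A).order = A.order := by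
  rw [PowerSeries.order_mul, ← PowerSeries.monomial_zero_eq_C_apply,
    PowerSeries.order_monomial_of_ne_zero 0 c hc]
  simp

end Reduction

/-! ## §2. The one-layer reading (any prime) -/

section Reading

variable {p : ℕ} [hp : Fact p.Prime]

/-- The reduction of the construction congruence: with `d = p^k(p−1)`,
`C ū · red L = red Θₙ − C β̄ · T^d · red Θₘ + T^{p^{k+1}} · red Q`. [cite: MazurTateTeitelbaum1986Invent, §I.10 (10.3)] -/
theorem red_layer {k : ℕ} (u β : ℤ_[p]) {L Θn Θm Q : IwasawaAlgebra p}
    (hrel : PowerSeries.C u * L =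
      Θn - PowerSeries.C β * toIwasawa p ((cyclotomic (p ^ (k + 1)) ℤ).comp (X + 1)) * Θm +
        toIwasawa p (cyclotomicOmega p (k + 1)) * Q) :
    PowerSeries.C (IsLocalRing.residue ℤ_[p] u) * red L =
      red Θn - PowerSeries.C (IsLocalRing.residue ℤ_[p] β) *
          (PowerSeries.X : PowerSeries (IsLocalRing.ResidueField ℤ_[p])) ^ (p ^ k * (p - 1)) * red Θm +
        (PowerSeries.X : PowerSeries (IsLocalRing.ResidueField ℤ_[p])) ^ (p ^ (k + 1)) * red Q := by
  have h := congr_arg red hrel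
  simp only [red_mul, red_add, red_sub, red_C, red_toIwasawa_cyclotomic_comp,
    red_toIwasawa_cyclotomicOmega] at h
  exact h

omit hp in
/-- `d = p^k(p−1) ≤ p^{k+1}`. [folklore] -/
private theorem deg_le (k : ℕ) : p ^ k * (p - 1) ≤ p ^ (k + 1) := by
  rw [pow_succ]
  exact Nat.mul_le_mul_left _ (Nat.sub_le p 1)

/-- **THE ONE-LAYER READING, from `L` to `Θₙ`.** `Λ = ℤ_p⟦T⟧`; suppose
`C u · L = Θₙ − C β · Φ_{p^{k+1}}(1+T) · Θₘ + ω_{k+1} · Q` with `u ∈ ℤ_p^×` (for a good ordinary prime: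
`L` = the `p`-adic `L`-function of `α`, `Θₙ, Θₘ` = integral models of `θ_{k+1}, θ_k`, `u = α^{k+1+e₀}`,
`β = α^{−1}` — Mazur–Tate–Teitelbaum (10.3); but `Θₘ`, `Q`, `β` are ARBITRARY here). If `L ≠ 0`,
`μ(L) = 0` and `λ(L) < p^k(p−1) = deg Φ_{p^{k+1}}`, then `Θₙ ≠ 0`, `μ(Θₙ) = 0` and `λ(Θₙ) = λ(L)`.
[cite: MazurTateTeitelbaum1986Invent, §I.10 (10.3)] -/
theorem lam_eq_of_layer {k : ℕ} {u : ℤ_[p]} (hu : IsUnit u) (β : ℤ_[p]) {L Θn Θm Q : IwasawaAlgebra p}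
    (hrel : PowerSeries.C u * L =
      Θn - PowerSeries.C β * toIwasawa p ((cyclotomic (p ^ (k + 1)) ℤ).comp (X + 1)) * Θm +
        toIwasawa p (cyclotomicOmega p (k + 1)) * Q)
    (hL0 : L ≠ 0) (hμ : mu L = 0) (hlt : lam L < p ^ k * (p - 1)) :
    Θn ≠ 0 ∧ mu Θn = 0 ∧ lam Θn = lam L := by
  have hredL : red L ≠ 0 := red_ne_zero_of_mu_eq_zero hL0 hμ
  obtain ⟨-, hlamL⟩ := mu_eq_zero_and_lam_eq_of_red_ne_zero hredL
  have hub : IsLocalRing.residue ℤ_[p] u ≠ 0 := residue_ne_zero_of_isUnit hu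
  have h := red_layer u β hrel
  set d : ℕ := p ^ k * (p - 1) with hd
  set X' : PowerSeries (IsLocalRing.ResidueField ℤ_[p]) := PowerSeries.X with hX'
  -- `C ū · red L = X^d · (−C β̄ · red Θₘ + X^{p^{k+1} − d} · red Q) + 1 · red Θₙ`
  have hshape : PowerSeries.C (IsLocalRing.residue ℤ_[p] u) * red L =
      X' ^ d * (-(PowerSeries.C (IsLocalRing.residue ℤ_[p] β) * red Θm) + X' ^ (p ^ (k + 1) - d) * red Q) +
        1 * red Θn := by
    have hpow : X' ^ (p ^ (k + 1)) = X' ^ d * X' ^ (p ^ (k + 1) - d) := by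
      rw [← pow_add, Nat.add_sub_cancel' (deg_le k)]
    rw [h, hpow]
    ring
  have hordlt : (PowerSeries.C (IsLocalRing.residue ℤ_[p] u) * red L).order < d := by
    rw [order_C_mul hub, ← hlamL]
    exact_mod_cast hlt
  obtain ⟨hredΘ, hord⟩ := order_eq_of_eq_X_pow_mul_add hshape hordlt
  obtain ⟨hμΘ, hlamΘ⟩ := mu_eq_zero_and_lam_eq_of_red_ne_zero hredΘ
  have hΘ0 : Θn ≠ 0 := by
    rintro rfl
    exact hredΘ (by rw [red, map_zero])
  refine ⟨hΘ0, hμΘ, ?_⟩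
  rw [order_C_mul hub, PowerSeries.order_one, zero_add, ← hlamL, ← hlamΘ] at hord
  exact_mod_cast hord.symm

/-- **THE ONE-LAYER READING, from `Θₙ` to `L`** (the direction an engine uses: it computes `θ_n`).
Same relation; if `Θₙ ≠ 0`, `μ(Θₙ) = 0` and `λ(Θₙ) < p^k(p−1)`, then `L ≠ 0`, `μ(L) = 0` and
`λ(L) = λ(Θₙ)`. [cite: MazurTateTeitelbaum1986Invent, §I.10 (10.3)] -/
theorem lam_eq_of_layer' {k : ℕ} {u : ℤ_[p]} (hu : IsUnit u) (β : ℤ_[p]) {L Θn Θm Q : IwasawaAlgebra p}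
    (hrel : PowerSeries.C u * L =
      Θn - PowerSeries.C β * toIwasawa p ((cyclotomic (p ^ (k + 1)) ℤ).comp (X + 1)) * Θm +
        toIwasawa p (cyclotomicOmega p (k + 1)) * Q)
    (hΘ0 : Θn ≠ 0) (hμ : mu Θn = 0) (hlt : lam Θn < p ^ k * (p - 1)) :
    L ≠ 0 ∧ mu L = 0 ∧ lam L = lam Θn := by
  have hredΘ : red Θn ≠ 0 := red_ne_zero_of_mu_eq_zero hΘ0 hμ
  obtain ⟨-, hlamΘ⟩ := mu_eq_zero_and_lam_eq_of_red_ne_zero hredΘ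
  have hub : IsLocalRing.residue ℤ_[p] u ≠ 0 := residue_ne_zero_of_isUnit hu
  have h := red_layer u β hrel
  set d : ℕ := p ^ k * (p - 1) with hd
  set X' : PowerSeries (IsLocalRing.ResidueField ℤ_[p]) := PowerSeries.X with hX'
  -- `red Θₙ = X^d · (C β̄ · red Θₘ − X^{p^{k+1} − d} · red Q) + C ū · red L`
  have hshape : red Θn =
      X' ^ d * (PowerSeries.C (IsLocalRing.residue ℤ_[p] β) * red Θm - X' ^ (p ^ (k + 1) - d) * red Q) +
        PowerSeries.C (IsLocalRing.residue ℤ_[p] u) * red L := by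
    have hpow : X' ^ (p ^ (k + 1)) = X' ^ d * X' ^ (p ^ (k + 1) - d) := by
      rw [← pow_add, Nat.add_sub_cancel' (deg_le k)]
    rw [h, hpow]
    ring
  have hordlt : (red Θn).order < d := by
    rw [← hlamΘ]
    exact_mod_cast hlt
  obtain ⟨hredL, hord⟩ := order_eq_of_eq_X_pow_mul_add hshape hordlt
  obtain ⟨hμL, hlamL⟩ := mu_eq_zero_and_lam_eq_of_red_ne_zero hredL
  have hL0 : L ≠ 0 := by
    rintro rfl
    exact hredL (by rw [red, map_zero])
  refine ⟨hL0, hμL, ?_⟩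
  rw [← PowerSeries.order_mul, order_C_mul hub, ← hlamL, ← hlamΘ] at hord
  exact_mod_cast hord.symm

end Reading

/-! ## §3. At `p = 2`: the parity law transfers along the reading -/

section Two

variable {N : ℕ} [NeZero N] {f : CuspForm (Gamma0 N) 2}

/-- **`(−1)^{λ(L)} = χ₈(N)` for any `L ∈ ℤ₂⟦T⟧ ∖ {0}` with `μ(L) = 0` tied to `θ_n(f)` by the
construction congruence at a layer `n ≥ 2` with `λ(L) < 2^{n−1}`.** Hypotheses: `f ∈ S₂(Γ₀(N))` with a
Fricke sign `σ = ±1` (either), `2 ∤ N`, `Θₙ ∈ Λ` an integral model of `θ_n(f)` (level `2^{n+2}`),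
`C u · L = Θₙ − C β · Φ_{2ⁿ}(1+T) · Θₘ + ω_n · Q` with `u ∈ ℤ₂^×` (`Θₘ, Q ∈ Λ`, `β ∈ ℤ₂` arbitrary; for
`E` good ordinary at `2`: `u = α^{n+2}`, `β = α^{−1}`, `Θₘ` a model of `θ_{n−1}`).
[cite: MazurTateTeitelbaum1986Invent, §I.10 (10.3) and §I.17] -/
theorem neg_one_pow_lam_of_layer_two {σ : ℤ} (hσ : σ = 1 ∨ σ = -1)
    (hW : IsFrickeEigen N f (-(σ : ℂ))) (hN2 : ¬ 2 ∣ N) {n : ℕ} (hn : 2 ≤ n)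
    {Θn Θm L Q : IwasawaAlgebra 2} {u : ℤ_[2]} (hu : IsUnit u) (β : ℤ_[2])
    (hΘ : iwasawaToPowerSeries 2 Θn =
      ((mazurTateElement f 2 n).map (algebraMap ℚ ℚ_[2]) : PowerSeries ℚ_[2]))
    (hrel : PowerSeries.C u * L =
      Θn - PowerSeries.C β * toIwasawa 2 ((cyclotomic (2 ^ n) ℤ).comp (X + 1)) * Θm +
        toIwasawa 2 (cyclotomicOmega 2 n) * Q)
    (hL0 : L ≠ 0) (hμ : mu L = 0) (hlt : lam L < 2 ^ (n - 1)) :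
    (-1 : ℤ) ^ lam L = ZMod.χ₈ (N : ZMod 8) := by
  obtain ⟨k, rfl⟩ : ∃ k, n = k + 1 := ⟨n - 1, by omega⟩
  have hk : k + 1 - 1 = k := by omega
  rw [hk] at hlt
  have hlt' : lam L < 2 ^ k * (2 - 1) := by simpa using hlt
  obtain ⟨hΘ0, hμΘ, hlam⟩ := lam_eq_of_layer hu β hrel hL0 hμ hlt'
  have hle : lam Θn + 2 ≤ 2 ^ (k + 1) := by
    have h1 : 1 ≤ 2 ^ k := Nat.one_le_two_pow
    rw [hlam, pow_succ]
    omega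
  rw [← hlam]
  exact neg_one_pow_lam_mazurTate_two hσ hW hN2 hn hΘ hΘ0 hμΘ hle

/-- **Corollary: `λ(L)` is even iff `N ≡ ±1 (mod 8)`** (same hypotheses).
[cite: MazurTateTeitelbaum1986Invent, §I.10 (10.3) and §I.17] -/
theorem even_lam_of_layer_two_iff {σ : ℤ} (hσ : σ = 1 ∨ σ = -1)
    (hW : IsFrickeEigen N f (-(σ : ℂ))) (hN2 : ¬ 2 ∣ N) {n : ℕ} (hn : 2 ≤ n)
    {Θn Θm L Q : IwasawaAlgebra 2} {u : ℤ_[2]} (hu : IsUnit u) (β : ℤ_[2])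
    (hΘ : iwasawaToPowerSeries 2 Θn =
      ((mazurTateElement f 2 n).map (algebraMap ℚ ℚ_[2]) : PowerSeries ℚ_[2]))
    (hrel : PowerSeries.C u * L =
      Θn - PowerSeries.C β * toIwasawa 2 ((cyclotomic (2 ^ n) ℤ).comp (X + 1)) * Θm +
        toIwasawa 2 (cyclotomicOmega 2 n) * Q)
    (hL0 : L ≠ 0) (hμ : mu L = 0) (hlt : lam L < 2 ^ (n - 1)) :
    Even (lam L) ↔ N % 8 = 1 ∨ N % 8 = 7 := by
  have key := neg_one_pow_lam_of_layer_two hσ hW hN2 hn hu β hΘ hrel hL0 hμ hlt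
  rw [ZMod.χ₈_nat_eq_if_mod_eight, if_neg (by omega)] at key
  constructor
  · intro hev
    by_contra hne
    rw [hev.neg_one_pow, if_neg hne] at key
    norm_num at key
  · intro h8
    rw [if_pos h8] at key
    exact (neg_one_pow_eq_one_iff_even (by norm_num)).mp key

/-- **The engine direction at `p = 2`**: if the integral model `Θₙ` of `θ_n(f)` has `μ(Θₙ) = 0` and
`λ(Θₙ) < 2^{n−1}` (what a modular-symbol engine certifies), then every `L` tied to it by the
construction congruence has `L ≠ 0`, `μ(L) = 0`, `λ(L) = λ(Θₙ)`, hence `(−1)^{λ(L)} = χ₈(N)`.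
[cite: MazurTateTeitelbaum1986Invent, §I.10 (10.3) and §I.17] -/
theorem lam_eq_and_neg_one_pow_of_layer_two {σ : ℤ} (hσ : σ = 1 ∨ σ = -1)
    (hW : IsFrickeEigen N f (-(σ : ℂ))) (hN2 : ¬ 2 ∣ N) {n : ℕ} (hn : 2 ≤ n)
    {Θn Θm L Q : IwasawaAlgebra 2} {u : ℤ_[2]} (hu : IsUnit u) (β : ℤ_[2])
    (hΘ : iwasawaToPowerSeries 2 Θn =
      ((mazurTateElement f 2 n).map (algebraMap ℚ ℚ_[2]) : PowerSeries ℚ_[2]))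
    (hrel : PowerSeries.C u * L =
      Θn - PowerSeries.C β * toIwasawa 2 ((cyclotomic (2 ^ n) ℤ).comp (X + 1)) * Θm +
        toIwasawa 2 (cyclotomicOmega 2 n) * Q)
    (hΘ0 : Θn ≠ 0) (hμ : mu Θn = 0) (hlt : lam Θn < 2 ^ (n - 1)) :
    L ≠ 0 ∧ mu L = 0 ∧ lam L = lam Θn ∧ (-1 : ℤ) ^ lam L = ZMod.χ₈ (N : ZMod 8) := by
  obtain ⟨k, rfl⟩ : ∃ k, n = k + 1 := ⟨n - 1, by omega⟩
  have hk : k + 1 - 1 = k := by omega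
  rw [hk] at hlt
  have hlt' : lam Θn < 2 ^ k * (2 - 1) := by simpa using hlt
  obtain ⟨hL0, hμL, hlam⟩ := lam_eq_of_layer' hu β hrel hΘ0 hμ hlt'
  have hle : lam Θn + 2 ≤ 2 ^ (k + 1) := by
    have h1 : 1 ≤ 2 ^ k := Nat.one_le_two_pow
    rw [pow_succ]
    omega
  refine ⟨hL0, hμL, hlam, ?_⟩
  rw [hlam]
  exact neg_one_pow_lam_mazurTate_two hσ hW hN2 hn hΘ hΘ0 hμ hle

end Two

end Summit.BirchSwinnertonDyer.Rank1Residual.Supersingular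

end
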